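import Mathlib
import Summits.NavierStokesRegularity.NavierStokesRegularity.Theorems.EulerZoomLiouvillePowerGaugeEulerLiouvilleMovingSpherePiercing
import Summits.NavierStokesRegularity.NavierStokesRegularity.Theorems.EulerZoomLiouvillePowerGaugeEulerLiouvilleSimilarityBernoulliRest
import HarnessLib.Audit

/-!
# Crux E `PowerGaugeEulerLiouville` (stmt-NavierStokesRegularity-19832): CLASSICAL MEMBERS WITH A SUB-BERNOULLI PRESSURE CLOCK,
# A TYPE-I CORE AND A SUBCRITICAL SLOW SET ARE TRIVIAL (key K-A″ of width seat ns-cas-k2: K-A without the confined-null binder)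

Route `EulerZoomLiouville` (NavierStokesRegularity), crux E.  ns-cas-k2 g0's K-A′ (`…MovingSpherePiercing`, p627425) proved the
DSS-piercing stratum MODULO the binder `hconf` («vortical points whose backward trajectory stays in the moving ball `‖x‖ < R(−σ)ⁿ`
are null»).  This file DISCHARGES `hconf` — the confined sets are even EMPTY — for classical members `(u, p)` on `(−∞,0)` with a
continuous gradient majorant `Λ` (Cauchy–Lipschitz flow) satisfying, for a similarity exponent `0 ≤ n < ½`:
(i) the SUB-BERNOULLI PRESSURE CLOCK `𝒟p := (−s)∂ₛp − n ∂ₓp·x − 2(1−n)p ≤ θ(1−2n)‖u + (n/(−s))x‖²` with `θ < 1` (`…SimilarityBernoulli`: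
the similarity Bernoulli function is then a Lyapunov function of the particle flow);
(ii) a TYPE-I CORE: on every moving ball `‖x‖ ≤ R(−s)ⁿ` the scale-invariant sizes `(−s)^{1−n}‖u‖`, `(−s)^{2−2n}p`,
`(−s)^{2−n}‖∇p‖`, `(−s)‖ω‖` are bounded (automatic for discretely self-similar members);
(iii) a SUBCRITICAL SLOW SET: on every moving ball there are `ε > 0`, `κ < 1` such that wherever the similarity speed
`(−s)^{1−n}‖u + (n/(−s))x‖` is `< ε` the stretching form is subcritical, `⟪∇u v, v⟫ ≤ κ‖v‖²/(−s)`.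
MECHANISM (`curl_eq_zero_of_confined`): along a confined backward trajectory the Bernoulli function is bounded, so the speed
budget holds, so the trajectory comes to REST in similarity variables (`tendsto_similaritySpeed_zero`), so it is eventually in the
slow set, where (iii) and the Type-I vorticity bound KILL its vorticity (`curl_eq_zero_of_eventually_subcritical`).  Hence:
* `ae_eq_zero_of_gauge_of_piercing_of_clock` — crux hypotheses (any `ρ > 0`) + (i)–(iii) + irrotational fast-inflow piercing of the
  moving spheres beyond every radius ⇒ trivial (K-A′ with `hconf` discharged);
* `ae_eq_zero_of_gauge_of_noFastInflow_of_clock` — the same with NO fast-inflow point on spheres beyond every radius (trapping: every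
  trajectory is confined; in particular when the scaled speed `(−s)^{1−n}‖u‖` is bounded on those spheres,
  `ae_eq_zero_of_gauge_of_boundedSpeed_of_clock`).

WHAT THIS IS NOT: not NS regularity, not the crux E — a stratum of hypothetical blow-up members; members violating the pressure
clock somewhere, or whose slow set carries critical stretching, are untouched. [folklore; ConstantinIgnatovaVicol2026Putative §3.4.3]
-/

noncomputable section

set_option linter.dupNamespace false

open MeasureTheory Set Filter Topology Metric Function
open scoped NNReal ENNReal ContDiff InnerProductSpace RealInnerProductSpace

namespace Summit.NavierStokesRegularity.NavierStokesRegularity.Theorems.PowerGaugeEulerLiouville.SimilarityBernoulli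

open Literature.Analysis Literature.Analysis.FluidPDE Literature.Analysis.FunctionSpaces
open Summit.NavierStokesRegularity.NavierStokesRegularity.Theorems.PowerGaugeEulerLiouville.VorticityBirth
open Summit.NavierStokesRegularity.NavierStokesRegularity.Theorems.PowerGaugeEulerLiouville.MovingSpherePiercing

variable {u : ℝ → EuclideanSpace ℝ (Fin 3) → EuclideanSpace ℝ (Fin 3)} {p : ℝ → EuclideanSpace ℝ (Fin 3) → ℝ}
  {Λ : ℝ → ℝ} {n θ : ℝ}

/-! ### Confined trajectories carry no vorticity -/

/-- **CONFINED BACKWARD TRAJECTORIES CARRY NO VORTICITY.**  Classical Euler on `(−∞,0)` with a continuous gradient majorant,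
`0 ≤ n < ½`, the pressure clock (i) with `θ < 1`; on the moving ball of radius `R`: the Type-I core bounds (ii) and the subcritical
slow set (iii) (`ε > 0`, `κ < 1`).  If the backward trajectory of `(τ₀, x₀)` stays in `‖x‖ ≤ R(−s)ⁿ` for all `s ≤ τ₀`, then
`ω(τ₀, x₀) = 0`. [folklore; ConstantinIgnatovaVicol2026Putative §3.4.3 (3.31)–(3.33) (mechanism, self-similar case)] -/
theorem curl_eq_zero_of_confined (hcl : IsClassicalEulerSolutionOn (Iio 0) 0 u p) (hΛc : ContinuousOn Λ (Iio 0))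
    (hΛ : ∀ s : ℝ, s < 0 → ∀ y, ‖fderiv ℝ (u s) y‖ ≤ Λ s) (hn0 : 0 ≤ n) (hn : n < 1 / 2) (hθ : θ < 1)
    (hclock : ∀ s : ℝ, s < 0 → ∀ x : EuclideanSpace ℝ (Fin 3),
      (-s) * timeDerivWithin (Iio 0) p s x - n * fderiv ℝ (p s) x x - 2 * (1 - n) * p s x ≤
        θ * (1 - 2 * n) * ‖u s x + (n / (-s)) • x‖ ^ 2)
    {R A P₀ G Cω ε κ : ℝ} (hε : 0 < ε) (hκ : κ < 1)
    (hA : ∀ s : ℝ, s < 0 → ∀ x : EuclideanSpace ℝ (Fin 3), ‖x‖ ≤ R * (-s) ^ n → (-s) ^ (1 - n) * ‖u s x‖ ≤ A)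
    (hP₀ : ∀ s : ℝ, s < 0 → ∀ x : EuclideanSpace ℝ (Fin 3), ‖x‖ ≤ R * (-s) ^ n → (-s) ^ (2 - 2 * n) * p s x ≤ P₀)
    (hG : ∀ s : ℝ, s < 0 → ∀ x : EuclideanSpace ℝ (Fin 3), ‖x‖ ≤ R * (-s) ^ n →
      (-s) ^ (2 - n) * ‖gradient (p s) x‖ ≤ G)
    (hCω : ∀ s : ℝ, s < 0 → ∀ x : EuclideanSpace ℝ (Fin 3), ‖x‖ ≤ R * (-s) ^ n → (-s) * ‖curl (u s) x‖ ≤ Cω)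
    (hslow : ∀ s : ℝ, s < 0 → ∀ x : EuclideanSpace ℝ (Fin 3), ‖x‖ ≤ R * (-s) ^ n →
      (-s) ^ (1 - n) * ‖u s x + (n / (-s)) • x‖ < ε →
        ∀ v : EuclideanSpace ℝ (Fin 3), ⟪fderiv ℝ (u s) x v, v⟫ ≤ κ / (-s) * ‖v‖ ^ 2)
    {τ₀ : ℝ} (hτ₀ : τ₀ < 0) {x₀ : EuclideanSpace ℝ (Fin 3)}
    (hconf : ∀ s : ℝ, s ≤ τ₀ → ‖ODE.evolutionMap u τ₀ s x₀‖ ≤ R * (-s) ^ n) :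
    curl (u τ₀) x₀ = 0 := by
  have hlip : ODE.IsUniformlyLipschitzOn u (Iio 0) := isUniformlyLipschitzOn hcl hΛc hΛ
  set X : ℝ → EuclideanSpace ℝ (Fin 3) := fun s => ODE.evolutionMap u τ₀ s x₀ with hX
  have hXd : ∀ s : ℝ, s < 0 → HasDerivAt X (u s (X s)) s := fun s hs =>
    hlip.hasDerivAt_evolutionMap (convex_Iio 0) hτ₀ (Iio_mem_nhds hs) x₀
  have hconf' : ∀ s : ℝ, s ≤ τ₀ → ‖X s‖ ≤ R * (-s) ^ n := hconf
  have hR : 0 ≤ R := by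
    have h := hconf τ₀ le_rfl
    have hpow : 0 < (-τ₀) ^ n := Real.rpow_pos_of_pos (by linarith) _
    nlinarith [norm_nonneg (ODE.evolutionMap u τ₀ τ₀ x₀)]
  have hA0 : 0 ≤ A :=
    (mul_nonneg (Real.rpow_nonneg (by linarith) _) (norm_nonneg _)).trans (hA τ₀ hτ₀ (X τ₀) (hconf' τ₀ le_rfl))
  -- the similarity Bernoulli function along the trajectory is bounded above by `Bmax`
  set B : ℝ → ℝ := fun s => (-s) ^ (2 - 2 * n) *
      (‖u s (X s)‖ ^ 2 / 2 + p s (X s) + n * ⟪X s, u s (X s)⟫ / (-s) - n * (1 - 2 * n) / 2 * ‖X s‖ ^ 2 / (-s) ^ 2) with hB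
  set Bmax : ℝ := A ^ 2 / 2 + P₀ + n * R * A with hBmax
  have hBle : ∀ s : ℝ, s ≤ τ₀ → B s ≤ Bmax := by
    intro s hs
    have hs0 : 0 < -s := by linarith
    have hsne : (-s) ≠ 0 := hs0.ne'
    have hp : 0 ≤ (-s) ^ (1 - n) := Real.rpow_nonneg hs0.le _
    have hp2 : 0 ≤ (-s) ^ (2 - 2 * n) := Real.rpow_nonneg hs0.le _
    have e22 : (-s) ^ (2 - 2 * n) = ((-s) ^ (1 - n)) ^ 2 := by
      rw [← Real.rpow_natCast ((-s) ^ (1 - n)) 2, ← Real.rpow_mul hs0.le]; push_cast; ring_nf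
    -- term 1
    have h1 : (-s) ^ (2 - 2 * n) * (‖u s (X s)‖ ^ 2 / 2) ≤ A ^ 2 / 2 := by
      rw [e22, show ((-s) ^ (1 - n)) ^ 2 * (‖u s (X s)‖ ^ 2 / 2) = ((-s) ^ (1 - n) * ‖u s (X s)‖) ^ 2 / 2 by ring]
      have := hA s (by linarith) (X s) (hconf' s hs)
      have h0 : 0 ≤ (-s) ^ (1 - n) * ‖u s (X s)‖ := mul_nonneg hp (norm_nonneg _)
      nlinarith
    -- term 2
    have h2 : (-s) ^ (2 - 2 * n) * p s (X s) ≤ P₀ := hP₀ s (by linarith) (X s) (hconf' s hs)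
    -- term 3
    have h3 : (-s) ^ (2 - 2 * n) * (n * ⟪X s, u s (X s)⟫ / (-s)) ≤ n * R * A := by
      have hin : ⟪X s, u s (X s)⟫ ≤ ‖X s‖ * ‖u s (X s)‖ := real_inner_le_norm _ _
      have hXR := hconf' s hs
      have e : (-s) ^ (2 - 2 * n) / (-s) = (-s) ^ (1 - n) * (-s) ^ (-n) := by
        rw [← Real.rpow_add hs0, show (1 - n + -n) = (2 - 2 * n) - 1 by ring, Real.rpow_sub_one hsne]
      have epow : (-s) ^ (-n) * (R * (-s) ^ n) = R := by
        rw [show (-s) ^ (-n) * (R * (-s) ^ n) = R * ((-s) ^ (-n) * (-s) ^ n) by ring, ← Real.rpow_add hs0,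
          neg_add_cancel, Real.rpow_zero, mul_one]
      calc (-s) ^ (2 - 2 * n) * (n * ⟪X s, u s (X s)⟫ / (-s))
          = n * ((-s) ^ (2 - 2 * n) / (-s)) * ⟪X s, u s (X s)⟫ := by ring
        _ ≤ n * ((-s) ^ (2 - 2 * n) / (-s)) * (‖X s‖ * ‖u s (X s)‖) :=
            mul_le_mul_of_nonneg_left hin (mul_nonneg hn0 (div_nonneg hp2 hs0.le))
        _ = n * (((-s) ^ (-n) * ‖X s‖) * ((-s) ^ (1 - n) * ‖u s (X s)‖)) := by rw [e]; ring
        _ ≤ n * (((-s) ^ (-n) * (R * (-s) ^ n)) * A) := by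
            refine mul_le_mul_of_nonneg_left (mul_le_mul (mul_le_mul_of_nonneg_left hXR (Real.rpow_nonneg hs0.le _))
              (hA s (by linarith) (X s) hXR) (mul_nonneg hp (norm_nonneg _)) ?_) hn0
            rw [epow]; exact hR
        _ = n * R * A := by rw [epow]; ring
    -- term 4 is nonpositive
    have h4 : 0 ≤ (-s) ^ (2 - 2 * n) * (n * (1 - 2 * n) / 2 * ‖X s‖ ^ 2 / (-s) ^ 2) := by
      have : 0 ≤ n * (1 - 2 * n) / 2 := by nlinarith
      positivity
    have hsplit : B s = (-s) ^ (2 - 2 * n) * (‖u s (X s)‖ ^ 2 / 2) + (-s) ^ (2 - 2 * n) * p s (X s) +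
        (-s) ^ (2 - 2 * n) * (n * ⟪X s, u s (X s)⟫ / (-s)) -
        (-s) ^ (2 - 2 * n) * (n * (1 - 2 * n) / 2 * ‖X s‖ ^ 2 / (-s) ^ 2) := by
      simp only [hB]; ring
    rw [hsplit, hBmax]
    linarith
  -- the speed budget
  have hcoef : 0 < (1 - θ) * (1 - 2 * n) := mul_pos (by linarith) (by linarith)
  set M : ℝ := (Bmax - B τ₀) / ((1 - θ) * (1 - 2 * n)) with hM
  have hbudget : ∀ a : ℝ, a ≤ τ₀ →
      ∫ s in a..τ₀, (-s) ^ (1 - 2 * n) * ‖u s (X s) + (n / (-s)) • X s‖ ^ 2 ≤ M := by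
    intro a ha
    have h : (1 - θ) * (1 - 2 * n) *
        (∫ s in a..τ₀, (-s) ^ (1 - 2 * n) * ‖u s (X s) + (n / (-s)) • X s‖ ^ 2) ≤ B a - B τ₀ :=
      integral_similaritySpeed_sq_le hcl hclock hXd ha hτ₀
    have h2 : B a - B τ₀ ≤ Bmax - B τ₀ := by linarith [hBle a ha]
    rw [hM, le_div_iff₀ hcoef, mul_comm]
    exact h.trans h2
  -- rest
  have hrest := tendsto_similaritySpeed_zero hcl hn0 (by linarith) hτ₀ hXd hconf'
    (fun s hs => hA s (by linarith) (X s) (hconf' s hs)) (fun s hs => hG s (by linarith) (X s) (hconf' s hs)) hbudget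
  obtain ⟨N, hN⟩ := eventually_atBot.1 (hrest.eventually (gt_mem_nhds hε))
  set σ₁ : ℝ := min N τ₀ with hσ₁
  have hσ₁τ : σ₁ ≤ τ₀ := min_le_right _ _
  -- kill
  have hsub : ∀ s : ℝ, s ≤ σ₁ → ∀ v : EuclideanSpace ℝ (Fin 3),
      ⟪fderiv ℝ (u s) (ODE.evolutionMap u τ₀ s x₀) v, v⟫ ≤ κ / (-s) * ‖v‖ ^ 2 := by
    intro s hs v
    have hsτ : s ≤ τ₀ := hs.trans hσ₁τ
    exact hslow s (by linarith) (X s) (hconf' s hsτ) (hN s (hs.trans (min_le_left _ _))) v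
  have hC : ∀ s : ℝ, s ≤ σ₁ → (-s) * ‖curl (u s) (ODE.evolutionMap u τ₀ s x₀)‖ ≤ Cω := by
    intro s hs
    have hsτ : s ≤ τ₀ := hs.trans hσ₁τ
    exact hCω s (by linarith) (X s) (hconf' s hsτ)
  exact curl_eq_zero_of_eventually_subcritical hcl hΛc hΛ hτ₀ hσ₁τ hκ hsub hC

/-! ### Member level -/

/-- **MEMBERS WITH A SUB-BERNOULLI PRESSURE CLOCK, A TYPE-I CORE, A SUBCRITICAL SLOW SET AND IRROTATIONAL FAST-INFLOW PIERCING
ARE TRIVIAL** (ns-cas-k2 g0's K-A′ `ae_eq_zero_of_gauge_of_piercing_of_confinedNull_allRho` with the confined-null binder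
DISCHARGED by `curl_eq_zero_of_confined`).  Crux hypotheses verbatim (any `ρ > 0`) + classical on the past with a continuous
gradient majorant + `0 ≤ n < ½` + (i) pressure clock (`θ < 1`) + for every radius `R > 0` the core data (ii)–(iii) + spheres
`‖x‖ = R(−σ)ⁿ` beyond every radius pierced only irrotationally at fast-inflow points ⇒ `u = 0` a.e. on `(−∞,0) × ℝ³`. [folklore] -/
theorem ae_eq_zero_of_gauge_of_piercing_of_clock {ρ : ℝ} (hρ : 0 < ρ)
    {H : ℝ → EuclideanSpace ℝ (Fin 3) → EuclideanSpace ℝ (Fin 3) →L[ℝ] EuclideanSpace ℝ (Fin 3)} {c₀ : ℝ≥0}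
    (hsw : IsSuitableWeakSolutionOn (slab (EuclideanSpace ℝ (Fin 3)) (Iio 0) isOpen_Iio) 0 0 u p)
    (hH : HasWeakSpatialGradientOn (slab (EuclideanSpace ℝ (Fin 3)) (Iio 0) isOpen_Iio) u H)
    (hgauge : ∀ a : ℝ, 0 < a →
      ENNReal.ofReal (a ^ (2 * ρ)) * cknA a (0 : ℝ × EuclideanSpace ℝ (Fin 3)) u +
          ENNReal.ofReal (a ^ ρ) * cknE a (0 : ℝ × EuclideanSpace ℝ (Fin 3)) H +
        ENNReal.ofReal (a ^ (2 * ρ)) * cknD a (0 : ℝ × EuclideanSpace ℝ (Fin 3)) p ≤ (c₀ : ℝ≥0∞))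
    (hcl : IsClassicalEulerSolutionOn (Iio 0) 0 u p) (hΛc : ContinuousOn Λ (Iio 0))
    (hΛ : ∀ s : ℝ, s < 0 → ∀ y, ‖fderiv ℝ (u s) y‖ ≤ Λ s) (hn0 : 0 ≤ n) (hn : n < 1 / 2) (hθ : θ < 1)
    (hclock : ∀ s : ℝ, s < 0 → ∀ x : EuclideanSpace ℝ (Fin 3),
      (-s) * timeDerivWithin (Iio 0) p s x - n * fderiv ℝ (p s) x x - 2 * (1 - n) * p s x ≤
        θ * (1 - 2 * n) * ‖u s x + (n / (-s)) • x‖ ^ 2)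
    (hcore : ∀ R : ℝ, 0 < R → ∃ A P₀ G Cω ε κ : ℝ, 0 < ε ∧ κ < 1 ∧
      (∀ s : ℝ, s < 0 → ∀ x : EuclideanSpace ℝ (Fin 3), ‖x‖ ≤ R * (-s) ^ n →
        (-s) ^ (1 - n) * ‖u s x‖ ≤ A ∧ (-s) ^ (2 - 2 * n) * p s x ≤ P₀ ∧ (-s) ^ (2 - n) * ‖gradient (p s) x‖ ≤ G ∧
          (-s) * ‖curl (u s) x‖ ≤ Cω ∧
          ((-s) ^ (1 - n) * ‖u s x + (n / (-s)) • x‖ < ε →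
            ∀ v : EuclideanSpace ℝ (Fin 3), ⟪fderiv ℝ (u s) x v, v⟫ ≤ κ / (-s) * ‖v‖ ^ 2)))
    (hS : ∀ R₀ : ℝ, ∃ R : ℝ, R₀ ≤ R ∧ ∀ σ : ℝ, σ < 0 → ∀ x : EuclideanSpace ℝ (Fin 3), ‖x‖ = R * (-σ) ^ n →
      ⟪x, u σ x⟫ ≤ -(n * ‖x‖ ^ 2 / (-σ)) → curl (u σ) x = 0) :
    uncurry u =ᵐ[volume.restrict (Iio (0 : ℝ) ×ˢ (univ : Set (EuclideanSpace ℝ (Fin 3))))] 0 := by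
  refine ae_eq_zero_of_gauge_of_piercing_of_confinedNull_allRho hρ hsw hH hgauge hcl hΛc hΛ hS fun τ₀ hτ₀ R hR => ?_
  obtain ⟨A, P₀, G, Cω, ε, κ, hε, hκ, hdata⟩ := hcore R hR
  have hempty : {x : EuclideanSpace ℝ (Fin 3) | curl (u τ₀) x ≠ 0 ∧
      ∀ σ : ℝ, σ ≤ τ₀ → ‖ODE.evolutionMap u τ₀ σ x‖ < R * (-σ) ^ n} = ∅ := by
    refine eq_empty_iff_forall_notMem.2 fun x hx => hx.1 ?_
    exact curl_eq_zero_of_confined hcl hΛc hΛ hn0 hn hθ hclock hε hκ (fun s hs y hy => (hdata s hs y hy).1)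
      (fun s hs y hy => (hdata s hs y hy).2.1) (fun s hs y hy => (hdata s hs y hy).2.2.1)
      (fun s hs y hy => (hdata s hs y hy).2.2.2.1) (fun s hs y hy => (hdata s hs y hy).2.2.2.2) hτ₀
      fun s hs => (hx.2 s hs).le
  rw [hempty, measure_empty]

/-- **MEMBERS WITH A SUB-BERNOULLI PRESSURE CLOCK, A TYPE-I CORE, A SUBCRITICAL SLOW SET AND NO FAST INFLOW AT LARGE SPHERES ARE
TRIVIAL** (trapping: with no fast-inflow point on the moving sphere every trajectory from inside is confined, and the piercing
hypothesis holds vacuously).  Crux hypotheses verbatim (any `ρ > 0`) + the data of `ae_eq_zero_of_gauge_of_piercing_of_clock` with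
`hS` replaced by: beyond every radius there is a moving sphere `‖x‖ = R(−σ)ⁿ` on which `⟪x, u σ x⟫ > −n‖x‖²/(−σ)` for all `σ < 0`.
[folklore] -/
theorem ae_eq_zero_of_gauge_of_noFastInflow_of_clock {ρ : ℝ} (hρ : 0 < ρ)
    {H : ℝ → EuclideanSpace ℝ (Fin 3) → EuclideanSpace ℝ (Fin 3) →L[ℝ] EuclideanSpace ℝ (Fin 3)} {c₀ : ℝ≥0}
    (hsw : IsSuitableWeakSolutionOn (slab (EuclideanSpace ℝ (Fin 3)) (Iio 0) isOpen_Iio) 0 0 u p)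
    (hH : HasWeakSpatialGradientOn (slab (EuclideanSpace ℝ (Fin 3)) (Iio 0) isOpen_Iio) u H)
    (hgauge : ∀ a : ℝ, 0 < a →
      ENNReal.ofReal (a ^ (2 * ρ)) * cknA a (0 : ℝ × EuclideanSpace ℝ (Fin 3)) u +
          ENNReal.ofReal (a ^ ρ) * cknE a (0 : ℝ × EuclideanSpace ℝ (Fin 3)) H +
        ENNReal.ofReal (a ^ (2 * ρ)) * cknD a (0 : ℝ × EuclideanSpace ℝ (Fin 3)) p ≤ (c₀ : ℝ≥0∞))
    (hcl : IsClassicalEulerSolutionOn (Iio 0) 0 u p) (hΛc : ContinuousOn Λ (Iio 0))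
    (hΛ : ∀ s : ℝ, s < 0 → ∀ y, ‖fderiv ℝ (u s) y‖ ≤ Λ s) (hn0 : 0 ≤ n) (hn : n < 1 / 2) (hθ : θ < 1)
    (hclock : ∀ s : ℝ, s < 0 → ∀ x : EuclideanSpace ℝ (Fin 3),
      (-s) * timeDerivWithin (Iio 0) p s x - n * fderiv ℝ (p s) x x - 2 * (1 - n) * p s x ≤
        θ * (1 - 2 * n) * ‖u s x + (n / (-s)) • x‖ ^ 2)
    (hcore : ∀ R : ℝ, 0 < R → ∃ A P₀ G Cω ε κ : ℝ, 0 < ε ∧ κ < 1 ∧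
      (∀ s : ℝ, s < 0 → ∀ x : EuclideanSpace ℝ (Fin 3), ‖x‖ ≤ R * (-s) ^ n →
        (-s) ^ (1 - n) * ‖u s x‖ ≤ A ∧ (-s) ^ (2 - 2 * n) * p s x ≤ P₀ ∧ (-s) ^ (2 - n) * ‖gradient (p s) x‖ ≤ G ∧
          (-s) * ‖curl (u s) x‖ ≤ Cω ∧
          ((-s) ^ (1 - n) * ‖u s x + (n / (-s)) • x‖ < ε →
            ∀ v : EuclideanSpace ℝ (Fin 3), ⟪fderiv ℝ (u s) x v, v⟫ ≤ κ / (-s) * ‖v‖ ^ 2)))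
    (hnoin : ∀ R₀ : ℝ, ∃ R : ℝ, R₀ ≤ R ∧ ∀ σ : ℝ, σ < 0 → ∀ x : EuclideanSpace ℝ (Fin 3), ‖x‖ = R * (-σ) ^ n →
      -(n * ‖x‖ ^ 2 / (-σ)) < ⟪x, u σ x⟫) :
    uncurry u =ᵐ[volume.restrict (Iio (0 : ℝ) ×ˢ (univ : Set (EuclideanSpace ℝ (Fin 3))))] 0 := by
  refine ae_eq_zero_of_gauge_of_piercing_of_clock hρ hsw hH hgauge hcl hΛc hΛ hn0 hn hθ hclock hcore fun R₀ => ?_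
  obtain ⟨R, hR, hRS⟩ := hnoin R₀
  exact ⟨R, hR, fun σ hσ x hx hfast => absurd hfast (not_le.2 (hRS σ hσ x hx))⟩

/-- **BOUNDED SCALED SPEED ON A LARGE SPHERE FORBIDS FAST INFLOW THERE**: if `(−σ)^{1−n}‖u(σ,x)‖ ≤ b` on the moving sphere
`‖x‖ = R(−σ)ⁿ` with `b < nR`, then `⟪x, u σ x⟫ > −n‖x‖²/(−σ)` on it (the trapping radius `R > b/n`). [folklore] -/
theorem noFastInflow_of_boundedSpeed {R b σ : ℝ} (hσ : σ < 0) (hbR : b < n * R)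
    (hb : ∀ x : EuclideanSpace ℝ (Fin 3), ‖x‖ = R * (-σ) ^ n → (-σ) ^ (1 - n) * ‖u σ x‖ ≤ b)
    {x : EuclideanSpace ℝ (Fin 3)} (hx : ‖x‖ = R * (-σ) ^ n) :
    -(n * ‖x‖ ^ 2 / (-σ)) < ⟪x, u σ x⟫ := by
  have hs0 : 0 < -σ := by linarith
  have hpn : 0 < (-σ) ^ n := Real.rpow_pos_of_pos hs0 _
  have hp1 : 0 < (-σ) ^ (1 - n) := Real.rpow_pos_of_pos hs0 _
  have hR : 0 < R := by
    have h0 : 0 ≤ b := le_trans (mul_nonneg hp1.le (norm_nonneg _)) (hb x hx)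
    by_contra hle
    push Not at hle
    have hn' : 0 ≤ n ∨ n < 0 := le_or_gt 0 n
    rcases hn' with hn' | hn'
    · nlinarith [mul_nonpos_of_nonneg_of_nonpos hn' hle]  -- n*R ≤ 0 ≤ b contradicts b < nR
    · -- n < 0: then nR > b ≥ 0 forces R < 0 and the norm identity gives x-sphere of negative radius
      have : ‖x‖ < 0 := by rw [hx]; nlinarith
      linarith [norm_nonneg x]
  have hxpos : 0 < ‖x‖ := by rw [hx]; positivity
  -- Cauchy–Schwarz: `⟪x,u⟫ ≥ −‖x‖‖u‖ ≥ −‖x‖ b (−σ)^{n−1}` and `b(−σ)^{n−1} < n‖x‖/(−σ)`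
  have hcs : -(‖x‖ * ‖u σ x‖) ≤ ⟪x, u σ x⟫ := by
    have := abs_real_inner_le_norm x (u σ x)
    have := neg_abs_le ⟪x, u σ x⟫
    linarith
  have hu : ‖u σ x‖ ≤ b / (-σ) ^ (1 - n) := by rw [le_div_iff₀ hp1, mul_comm]; exact hb x hx
  have hkey : b / (-σ) ^ (1 - n) < n * ‖x‖ / (-σ) := by
    rw [hx, div_lt_div_iff₀ hp1 hs0]
    have e : n * (R * (-σ) ^ n) * (-σ) ^ (1 - n) = n * R * (-σ) := by
      rw [show n * (R * (-σ) ^ n) * (-σ) ^ (1 - n) = n * R * ((-σ) ^ n * (-σ) ^ (1 - n)) by ring,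
        ← Real.rpow_add hs0, show n + (1 - n) = (1 : ℝ) by ring, Real.rpow_one]
    rw [e]
    nlinarith
  have h1 : ‖x‖ * ‖u σ x‖ ≤ ‖x‖ * (b / (-σ) ^ (1 - n)) := mul_le_mul_of_nonneg_left hu hxpos.le
  have h2 : ‖x‖ * (b / (-σ) ^ (1 - n)) < ‖x‖ * (n * ‖x‖ / (-σ)) := mul_lt_mul_of_pos_left hkey hxpos
  have h3 : ‖x‖ * (n * ‖x‖ / (-σ)) = n * ‖x‖ ^ 2 / (-σ) := by ring
  linarith

/-- **MEMBERS WITH A SUB-BERNOULLI PRESSURE CLOCK, A TYPE-I CORE, A SUBCRITICAL SLOW SET AND BOUNDED SCALED SPEED ON LARGE SPHERES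
ARE TRIVIAL**: the data of `ae_eq_zero_of_gauge_of_noFastInflow_of_clock` with the last hypothesis replaced by a bound
`(−σ)^{1−n}‖u(σ,x)‖ ≤ b` on the moving spheres `‖x‖ = R(−σ)ⁿ` for all `R ≥ R₁` (`n > 0`; e.g. a member with BOUNDED similarity
profile).  Then every backward trajectory is trapped in a moving ball, hence carries no vorticity. [folklore] -/
theorem ae_eq_zero_of_gauge_of_boundedSpeed_of_clock {ρ : ℝ} (hρ : 0 < ρ)
    {H : ℝ → EuclideanSpace ℝ (Fin 3) → EuclideanSpace ℝ (Fin 3) →L[ℝ] EuclideanSpace ℝ (Fin 3)} {c₀ : ℝ≥0}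
    (hsw : IsSuitableWeakSolutionOn (slab (EuclideanSpace ℝ (Fin 3)) (Iio 0) isOpen_Iio) 0 0 u p)
    (hH : HasWeakSpatialGradientOn (slab (EuclideanSpace ℝ (Fin 3)) (Iio 0) isOpen_Iio) u H)
    (hgauge : ∀ a : ℝ, 0 < a →
      ENNReal.ofReal (a ^ (2 * ρ)) * cknA a (0 : ℝ × EuclideanSpace ℝ (Fin 3)) u +
          ENNReal.ofReal (a ^ ρ) * cknE a (0 : ℝ × EuclideanSpace ℝ (Fin 3)) H +
        ENNReal.ofReal (a ^ (2 * ρ)) * cknD a (0 : ℝ × EuclideanSpace ℝ (Fin 3)) p ≤ (c₀ : ℝ≥0∞))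
    (hcl : IsClassicalEulerSolutionOn (Iio 0) 0 u p) (hΛc : ContinuousOn Λ (Iio 0))
    (hΛ : ∀ s : ℝ, s < 0 → ∀ y, ‖fderiv ℝ (u s) y‖ ≤ Λ s) (hn0 : 0 < n) (hn : n < 1 / 2) (hθ : θ < 1)
    (hclock : ∀ s : ℝ, s < 0 → ∀ x : EuclideanSpace ℝ (Fin 3),
      (-s) * timeDerivWithin (Iio 0) p s x - n * fderiv ℝ (p s) x x - 2 * (1 - n) * p s x ≤
        θ * (1 - 2 * n) * ‖u s x + (n / (-s)) • x‖ ^ 2)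
    (hcore : ∀ R : ℝ, 0 < R → ∃ A P₀ G Cω ε κ : ℝ, 0 < ε ∧ κ < 1 ∧
      (∀ s : ℝ, s < 0 → ∀ x : EuclideanSpace ℝ (Fin 3), ‖x‖ ≤ R * (-s) ^ n →
        (-s) ^ (1 - n) * ‖u s x‖ ≤ A ∧ (-s) ^ (2 - 2 * n) * p s x ≤ P₀ ∧ (-s) ^ (2 - n) * ‖gradient (p s) x‖ ≤ G ∧
          (-s) * ‖curl (u s) x‖ ≤ Cω ∧
          ((-s) ^ (1 - n) * ‖u s x + (n / (-s)) • x‖ < ε →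
            ∀ v : EuclideanSpace ℝ (Fin 3), ⟪fderiv ℝ (u s) x v, v⟫ ≤ κ / (-s) * ‖v‖ ^ 2)))
    {b R₁ : ℝ} (hb : ∀ R : ℝ, R₁ ≤ R → ∀ σ : ℝ, σ < 0 → ∀ x : EuclideanSpace ℝ (Fin 3), ‖x‖ = R * (-σ) ^ n →
      (-σ) ^ (1 - n) * ‖u σ x‖ ≤ b) :
    uncurry u =ᵐ[volume.restrict (Iio (0 : ℝ) ×ˢ (univ : Set (EuclideanSpace ℝ (Fin 3))))] 0 := by
  refine ae_eq_zero_of_gauge_of_noFastInflow_of_clock hρ hsw hH hgauge hcl hΛc hΛ hn0.le hn hθ hclock hcore fun R₀ => ?_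
  set R : ℝ := max (max R₀ R₁) (b / n + 1) with hR
  have hR₀ : R₀ ≤ R := (le_max_left _ _).trans (le_max_left _ _)
  have hR₁ : R₁ ≤ R := (le_max_right _ _).trans (le_max_left _ _)
  have hbR : b < n * R := by
    have h1 : b / n + 1 ≤ R := le_max_right _ _
    have h2 : b / n < R := by linarith
    rwa [div_lt_iff₀ hn0, mul_comm] at h2
  exact ⟨R, hR₀, fun σ hσ x hx => noFastInflow_of_boundedSpeed hσ hbR (hb R hR₁ σ hσ) hx⟩

end Summit.NavierStokesRegularity.NavierStokesRegularity.Theorems.PowerGaugeEulerLiouville.SimilarityBernoulli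

end
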